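import Summits.NavierStokesRegularity.FluidComputer.PalasekTowerGermHost
import Summits.NavierStokesRegularity.FluidComputer.PalasekTowerGermEvenProfile
import Literature.Analysis.FluidPDE.HeatDuhamelBack

/-!
# The germ host, VI: the anchor test of a SYMMETRIC COMPOSITE profile reduces to ONE far-field pressure number

Cell `ns-blowup`, seat `ns-blowup-ecbridge-3` (g3); GROUP C «BRIDGE SUPPORT» of the route
`PalasekTowerBreakdown` (crux `EpisodeBaseG`, item stmt-NavierStokesRegularity-19179, R2 of record).
LABEL: E–C typing (KERNEL: two elementary predicates — even / odd about a point — and identities).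
WHAT THIS IS NOT: not Navier–Stokes evidence — pointwise calculus of the NS acceleration
`V = P(νΔU − (U·∇)U)` of a PRESCRIBED profile; no flow, stage or tower is built and no profile is
claimed to pass the test.

## What and why

The slot `Germ.LevelZeroData U ρ` (p443639) asks the STRICT ANCHOR TEST `⟪U(x₀), V(x₀)⟫ > 0` at every
argmax `x₀` of `‖U‖`, `V = accel ν U = νΔU − (U·∇)U − ∇π`, `π = Δ⁻¹ div(νΔU − (U·∇)U)` (the tree's
`divPotential`) — a NONLOCAL condition (the pressure). This file makes it computable for the natural
composite designs `U = U₁ + U₂` — a carrier `U₁` of the speed maximum, SYMMETRIC (even) about `x₀`, plus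
far structures `U₂` (the strain / core-loop carriers, an energetic pusher) with `tsupport U₁`,
`tsupport U₂` DISJOINT and `x₀ ∉ tsupport U₂`:

* §1 reflection about a point, even / odd fields; an even field has zero derivative at the centre, its
  self-convection `(U·∇)U` is odd, the divergence of an odd field is even;
* §2 for an EVEN divergence-free profile the pressure potential `π` is even about `x₀` (the Newtonian
  potential commutes with the reflection — a change of variables in `divPotential_apply`; the
  origin-centred flat case is seat ecbridge-4's `PalasekTowerGermEvenProfile`, reused here), so
  `∇π(x₀) = 0`, `(U·∇)U(x₀) = 0` and **`V(x₀) = νΔU(x₀)`**: a symmetric carrier ALONE always FAILS the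
  strict test (`⟪U, ΔU⟫(x₀) ≤ 0` at a maximum, `Stage.inner_laplacian_τ_zero_le`) — the push must come
  from elsewhere;
* §3 DISJOINT SUPPORTS: drift, potential and acceleration are additive (`(U₁·∇)U₂ = 0` pointwise), and
  at a point off `tsupport U₂` the far field contributes `−∇π[U₂]` only
  (`accel_eventuallyEq_neg_gradient`);
* §4 **`inner_accel_of_even_add_far`**: `⟪U(x₀), V(x₀)⟫ = ν⟪U₁(x₀), ΔU₁(x₀)⟫ − ⟪U₁(x₀), ∇π[U₂](x₀)⟫` — the
  test for such a design is ONE inequality: the far structures' pressure gradient at `x₀` must push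
  along `U₁(x₀)` harder than viscosity brakes, `−⟪U₁(x₀), ∇π[U₂](x₀)⟫ > −ν⟪U₁(x₀), ΔU₁(x₀)⟫ (≥ 0)`.

References: A. J. Majda, A. L. Bertozzi, *Vorticity and Incompressible Flow* (CUP 2002), §1.8
Prop. 1.16 (Leray–Helmholtz projection, the pressure Poisson equation) [cite: MajdaBertozziCUP2002, §1.8 Prop. 1.16];
D. Gilbarg, N. S. Trudinger, *Elliptic PDE of Second Order* (2001), §2.4 (Newtonian potential)
[cite: GilbargTrudinger2001, Lemma 4.1].
-/

noncomputable section

namespace Summit.NavierStokesRegularity.FluidComputer.PalasekTowerClayBridge.Germ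

open Set Function Filter Topology InnerProductSpace Metric MeasureTheory
open scoped Topology ContDiff RealInnerProductSpace Laplacian

open Literature.Analysis.FluidPDE

/-! ## §1 Reflection about a point; even and odd fields -/

/-- **Reflection about `x₀`**: `x ↦ x₀ + (x₀ − x) = 2x₀ − x`. [folklore] -/
def reflectAbout (x₀ x : EuclideanSpace ℝ (Fin 3)) : EuclideanSpace ℝ (Fin 3) := x₀ + (x₀ - x)

section Reflect

variable (x₀ : EuclideanSpace ℝ (Fin 3))

/-- The reflection fixes its centre. [folklore] -/
@[simp] theorem reflectAbout_self : reflectAbout x₀ x₀ = x₀ := by simp [reflectAbout]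

/-- The reflection is an involution. [folklore] -/
@[simp] theorem reflectAbout_reflectAbout (x : EuclideanSpace ℝ (Fin 3)) :
    reflectAbout x₀ (reflectAbout x₀ x) = x := by
  simp [reflectAbout]

/-- `R x − R t = −(x − t)`. [folklore] -/
theorem reflectAbout_sub_reflectAbout (x t : EuclideanSpace ℝ (Fin 3)) :
    reflectAbout x₀ x - reflectAbout x₀ t = -(x - t) := by
  unfold reflectAbout; abel

/-- The reflection has derivative `−id` everywhere. [folklore] -/
theorem hasFDerivAt_reflectAbout (x : EuclideanSpace ℝ (Fin 3)) :
    HasFDerivAt (reflectAbout x₀) (-(ContinuousLinearMap.id ℝ (EuclideanSpace ℝ (Fin 3)))) x := by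
  have h : HasFDerivAt (fun y : EuclideanSpace ℝ (Fin 3) => x₀ + (x₀ - y))
      ((0 : EuclideanSpace ℝ (Fin 3) →L[ℝ] EuclideanSpace ℝ (Fin 3)) -
        ContinuousLinearMap.id ℝ (EuclideanSpace ℝ (Fin 3))) x :=
    ((hasFDerivAt_const (𝕜 := ℝ) x₀ x).sub (hasFDerivAt_id (𝕜 := ℝ) x)).const_add x₀
  rw [zero_sub] at h
  exact h

/-- `fderiv` of the reflection. [folklore] -/
theorem fderiv_reflectAbout (x : EuclideanSpace ℝ (Fin 3)) :
    fderiv ℝ (reflectAbout x₀) x = -(ContinuousLinearMap.id ℝ (EuclideanSpace ℝ (Fin 3))) :=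
  (hasFDerivAt_reflectAbout x₀ x).fderiv

/-- The reflection is differentiable. [folklore] -/
theorem differentiable_reflectAbout : Differentiable ℝ (reflectAbout x₀) :=
  fun x => (hasFDerivAt_reflectAbout x₀ x).differentiableAt

end Reflect

/-- **Even about `x₀`**: `f (2x₀ − x) = f x`. [folklore] -/
def IsEvenAbout {F : Type*} (x₀ : EuclideanSpace ℝ (Fin 3)) (f : EuclideanSpace ℝ (Fin 3) → F) : Prop :=
  ∀ x, f (reflectAbout x₀ x) = f x

/-- **Odd about `x₀`**: `f (2x₀ − x) = −f x`. [folklore] -/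
def IsOddAbout {F : Type*} [Neg F] (x₀ : EuclideanSpace ℝ (Fin 3)) (f : EuclideanSpace ℝ (Fin 3) → F) :
    Prop :=
  ∀ x, f (reflectAbout x₀ x) = -f x

section EvenOdd

variable {x₀ : EuclideanSpace ℝ (Fin 3)}
variable {F : Type*} [NormedAddCommGroup F] [NormedSpace ℝ F]

/-- **The derivative of an even field is odd**: `Df(2x₀ − x) v = −Df(x) v`. [folklore] -/
theorem IsEvenAbout.fderiv_apply {f : EuclideanSpace ℝ (Fin 3) → F} (hf : Differentiable ℝ f)
    (he : IsEvenAbout x₀ f) (x v : EuclideanSpace ℝ (Fin 3)) :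
    fderiv ℝ f (reflectAbout x₀ x) v = -fderiv ℝ f x v := by
  have hcomp : f ∘ reflectAbout x₀ = f := funext fun y => he y
  have h := (hf (reflectAbout x₀ x)).hasFDerivAt.comp x (hasFDerivAt_reflectAbout x₀ x)
  rw [hcomp] at h
  have h2 := congrArg (fun L : EuclideanSpace ℝ (Fin 3) →L[ℝ] F => L v) h.fderiv
  simp at h2
  rw [h2, neg_neg]

/-- **The derivative of an odd field is even**: `Df(2x₀ − x) v = Df(x) v`. [folklore] -/
theorem IsOddAbout.fderiv_apply {f : EuclideanSpace ℝ (Fin 3) → F} (hf : Differentiable ℝ f)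
    (ho : IsOddAbout x₀ f) (x v : EuclideanSpace ℝ (Fin 3)) :
    fderiv ℝ f (reflectAbout x₀ x) v = fderiv ℝ f x v := by
  have hcomp : f ∘ reflectAbout x₀ = fun y => -f y := funext fun y => ho y
  have h := (hf (reflectAbout x₀ x)).hasFDerivAt.comp x (hasFDerivAt_reflectAbout x₀ x)
  rw [hcomp] at h
  have h2 := congrArg (fun L : EuclideanSpace ℝ (Fin 3) →L[ℝ] F => L v) h.fderiv
  simp only [fderiv_fun_neg] at h2
  simp at h2
  rw [h2]

/-- **An even field has zero derivative at the centre.** [folklore] -/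
theorem IsEvenAbout.fderiv_center {f : EuclideanSpace ℝ (Fin 3) → F} (hf : Differentiable ℝ f)
    (he : IsEvenAbout x₀ f) : fderiv ℝ f x₀ = 0 := by
  ext v
  have h := he.fderiv_apply hf x₀ v
  rw [reflectAbout_self] at h
  have : (2 : ℝ) • fderiv ℝ f x₀ v = 0 := by rw [two_smul]; nth_rewrite 1 [h]; simp
  simpa using this

/-- An even scalar field has zero gradient at the centre. [folklore] -/
theorem IsEvenAbout.gradient_center {π : EuclideanSpace ℝ (Fin 3) → ℝ} (hπ : Differentiable ℝ π)
    (he : IsEvenAbout x₀ π) : gradient π x₀ = 0 := by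
  rw [gradient, he.fderiv_center hπ, map_zero]

/-- **The self-convection of an even field is odd**: `(U·∇)U (2x₀ − x) = −(U·∇)U (x)`. [folklore] -/
theorem IsEvenAbout.isOddAbout_convect {U : EuclideanSpace ℝ (Fin 3) → EuclideanSpace ℝ (Fin 3)}
    (hU : Differentiable ℝ U) (he : IsEvenAbout x₀ U) : IsOddAbout x₀ (convect U U) := by
  intro x
  rw [convect_apply, convect_apply, he x, he.fderiv_apply hU x]

/-- … so it vanishes at the centre. [folklore] -/
theorem IsEvenAbout.convect_center {U : EuclideanSpace ℝ (Fin 3) → EuclideanSpace ℝ (Fin 3)}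
    (hU : Differentiable ℝ U) (he : IsEvenAbout x₀ U) : convect U U x₀ = 0 := by
  rw [convect_apply, he.fderiv_center hU]
  rfl

/-- **The divergence of an odd field is even.** [folklore] -/
theorem IsOddAbout.isEvenAbout_divergence {c : EuclideanSpace ℝ (Fin 3) → EuclideanSpace ℝ (Fin 3)}
    (hc : Differentiable ℝ c) (ho : IsOddAbout x₀ c) :
    IsEvenAbout x₀ (VectorCalculus.divergence c) := by
  intro x
  have hD : fderiv ℝ c (reflectAbout x₀ x) = fderiv ℝ c x :=
    ContinuousLinearMap.ext fun v => ho.fderiv_apply hc x v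
  simp only [VectorCalculus.divergence, hD]

/-- The Laplacian of an even `C²` field is even (`Δ(U ∘ R) = (ΔU) ∘ R` for the reflection `R`,
whose derivative is `−id`; and `U ∘ R = U`). [folklore] -/
theorem IsEvenAbout.laplacian {U : EuclideanSpace ℝ (Fin 3) → F} (hU : ContDiff ℝ 2 U)
    (he : IsEvenAbout x₀ U) : IsEvenAbout x₀ (Δ U) := by
  intro x
  set b := EuclideanSpace.basisFun (Fin 3) ℝ with hb
  have hR2 : ContDiff ℝ 2 (reflectAbout x₀) := contDiff_const.add (contDiff_const.sub contDiff_id)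
  have hcomp : U ∘ reflectAbout x₀ = U := funext fun y => he y
  have hUd : Differentiable ℝ U := hU.differentiable (by norm_num)
  -- first derivatives of `U ∘ R` along `b i`
  have hfirst : ∀ i, (fun z => fderiv ℝ (U ∘ reflectAbout x₀) z (b i)) =
      fun z => -((fun y => fderiv ℝ U y (b i)) ∘ reflectAbout x₀) z := by
    intro i; funext z
    rw [((hUd _).hasFDerivAt.comp z (hasFDerivAt_reflectAbout x₀ z)).fderiv]
    simp
  have hg : ∀ i, Differentiable ℝ (fun y => fderiv ℝ U y (b i)) := fun i =>
    ((hU.fderiv_right (m := 1) (by norm_num)).clm_apply contDiff_const).differentiable (by simp)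
  -- second derivatives
  have hsecond : ∀ i, fderiv ℝ (fun z => fderiv ℝ (U ∘ reflectAbout x₀) z (b i)) x (b i) =
      fderiv ℝ (fun y => fderiv ℝ U y (b i)) (reflectAbout x₀ x) (b i) := by
    intro i
    rw [hfirst i, fderiv_fun_neg,
      ((hg i (reflectAbout x₀ x)).hasFDerivAt.comp x (hasFDerivAt_reflectAbout x₀ x)).fderiv]
    simp
  calc (Δ U) (reflectAbout x₀ x)
      = ∑ i, fderiv ℝ (fun y => fderiv ℝ U y (b i)) (reflectAbout x₀ x) (b i) :=
        laplacian_eq_sum_fderiv_fderiv_normed b hU _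
    _ = ∑ i, fderiv ℝ (fun z => fderiv ℝ (U ∘ reflectAbout x₀) z (b i)) x (b i) := by
        simp only [hsecond]
    _ = (Δ (U ∘ reflectAbout x₀)) x := (laplacian_eq_sum_fderiv_fderiv_normed b (hU.comp hR2) x).symm
    _ = (Δ U) x := by rw [hcomp]

end EvenOdd

/-! ## §2 An even divergence-free profile: `∇π(x₀) = 0` and `V(x₀) = νΔU(x₀)` -/

section EvenProfile

variable {ν : ℝ} {U : EuclideanSpace ℝ (Fin 3) → EuclideanSpace ℝ (Fin 3)} {x₀ : EuclideanSpace ℝ (Fin 3)}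
  (hU : ContDiff ℝ ∞ U) (hUc : HasCompactSupport U) (hdiv : VectorCalculus.IsDivFree U)
include hU hdiv

/-- **For an even profile the divergence of the drift is even.** [folklore] -/
theorem IsEvenAbout.isEvenAbout_divergence_drift (he : IsEvenAbout x₀ U) (ν : ℝ) :
    IsEvenAbout x₀ (VectorCalculus.divergence (drift ν U)) := by
  intro x
  have hodd := he.isOddAbout_convect (hU.differentiable (by simp))
  have hev := hodd.isEvenAbout_divergence ((contDiff_convect_self hU).differentiable (by simp))
  rw [divergence_drift hU hdiv, divergence_drift hU hdiv, hev x]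

/-- **For an even profile the pressure potential `π = Δ⁻¹ div W` is even about `x₀`** (the Newtonian
potential commutes with the reflection: substitute `t ↦ 2x₀ − t` in `π(x) = ∫ Γ(x − t) div W(t) dt`,
`Γ` even). [cite: GilbargTrudinger2001, Lemma 4.1] -/
theorem IsEvenAbout.isEvenAbout_pot (he : IsEvenAbout x₀ U) (ν : ℝ) : IsEvenAbout x₀ (pot ν U) := by
  intro x
  have hg := he.isEvenAbout_divergence_drift hU hdiv ν
  rw [pot, divPotential_apply, divPotential_apply]
  -- change variables `t ↦ 2x₀ − t`
  have hsub := integral_sub_left_eq_self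
    (fun t => newtonKernel (reflectAbout x₀ x - t) * VectorCalculus.divergence (drift ν U) t)
    (volume : Measure (EuclideanSpace ℝ (Fin 3))) (x₀ + x₀)
  rw [← hsub]
  refine integral_congr_ae (Eventually.of_forall fun t => ?_)
  have hR : x₀ + x₀ - t = reflectAbout x₀ t := by simp [reflectAbout]; abel
  simp only [hR, reflectAbout_sub_reflectAbout, hg t]
  congr 1
  rw [newtonKernel, newtonKernel, norm_neg]

include hUc

/-- **`∇π(x₀) = 0` for an even profile.** [folklore] -/
theorem IsEvenAbout.gradient_pot_center (he : IsEvenAbout x₀ U) (ν : ℝ) : gradient (pot ν U) x₀ = 0 :=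
  (he.isEvenAbout_pot hU hdiv ν).gradient_center ((contDiff_pot hU hUc ν).differentiable (by simp))

/-- **`V(x₀) = νΔU(x₀)` for an even profile** (`(U·∇)U(x₀) = 0`, `∇π(x₀) = 0`). [folklore] -/
theorem IsEvenAbout.accel_center (he : IsEvenAbout x₀ U) (ν : ℝ) : accel ν U x₀ = ν • (Δ U) x₀ := by
  rw [accel_apply, he.gradient_pot_center hU hUc hdiv ν, sub_zero, drift,
    he.convect_center (hU.differentiable (by simp)), sub_zero]

/-- **The anchor test value of an even profile at its centre is the VISCOUS term alone**:
`⟪U(x₀), V(x₀)⟫ = ν⟪U(x₀), ΔU(x₀)⟫` — nonpositive at a speed maximum, so a symmetric carrier alone never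
passes the strict test. [folklore] -/
theorem IsEvenAbout.inner_accel_center (he : IsEvenAbout x₀ U) (ν : ℝ) :
    ⟪U x₀, accel ν U x₀⟫ = ν * ⟪U x₀, (Δ U) x₀⟫ := by
  rw [he.accel_center hU hUc hdiv ν, real_inner_smul_right]

end EvenProfile

/-! ## §3 Disjoint supports: additivity, and the far field contributes a pressure gradient only -/

section Disjoint

variable {ν : ℝ} {U₁ U₂ : EuclideanSpace ℝ (Fin 3) → EuclideanSpace ℝ (Fin 3)}
  (h₁ : ContDiff ℝ ∞ U₁) (h₁c : HasCompactSupport U₁) (h₂ : ContDiff ℝ ∞ U₂) (h₂c : HasCompactSupport U₂)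
  (hd : Disjoint (tsupport U₁) (tsupport U₂))

/-- Off its support a smooth field has zero derivative. [folklore] -/
theorem fderiv_eq_zero_of_notMem_tsupport {U : EuclideanSpace ℝ (Fin 3) → EuclideanSpace ℝ (Fin 3)}
    {x : EuclideanSpace ℝ (Fin 3)} (hx : x ∉ tsupport U) : fderiv ℝ U x = 0 := by
  have hev : U =ᶠ[𝓝 x] fun _ => 0 := by
    filter_upwards [(isClosed_tsupport U).isOpen_compl.mem_nhds hx] with y hy
    exact image_eq_zero_of_notMem_tsupport hy
  rw [hev.fderiv_eq]
  exact fderiv_const_apply 0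

include h₁ h₂ hd

/-- **Disjoint supports do not convect each other**: `((U₁+U₂)·∇)(U₁+U₂) = (U₁·∇)U₁ + (U₂·∇)U₂`
pointwise. [folklore] -/
theorem convect_add_of_disjoint (x : EuclideanSpace ℝ (Fin 3)) :
    convect (U₁ + U₂) (U₁ + U₂) x = convect U₁ U₁ x + convect U₂ U₂ x := by
  have hd₁ : DifferentiableAt ℝ U₁ x := (h₁.differentiable (by simp)) x
  have hd₂ : DifferentiableAt ℝ U₂ x := (h₂.differentiable (by simp)) x
  rw [convect_apply, convect_apply, convect_apply, fderiv_add hd₁ hd₂]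
  by_cases hx : x ∈ tsupport U₁
  · have hx2 : x ∉ tsupport U₂ := fun h => hd.le_bot ⟨hx, h⟩
    simp [image_eq_zero_of_notMem_tsupport hx2, fderiv_eq_zero_of_notMem_tsupport hx2]
  · simp [image_eq_zero_of_notMem_tsupport hx, fderiv_eq_zero_of_notMem_tsupport hx]

/-- The drift is additive on disjoint supports. [folklore] -/
theorem drift_add_of_disjoint : drift ν (U₁ + U₂) = fun x => drift ν U₁ x + drift ν U₂ x := by
  funext x
  have hU₁2 : ContDiff ℝ 2 U₁ := h₁.of_le (by norm_cast)
  have hU₂2 : ContDiff ℝ 2 U₂ := h₂.of_le (by norm_cast)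
  rw [drift, drift, drift, convect_add_of_disjoint h₁ h₂ hd x,
    hU₁2.contDiffAt.laplacian_add hU₂2.contDiffAt]
  simp only [smul_add]
  abel

include h₁c h₂c

/-- The pressure potential is additive on disjoint supports. [folklore] -/
theorem pot_add_of_disjoint : pot ν (U₁ + U₂) = fun x => pot ν U₁ x + pot ν U₂ x := by
  rw [pot, drift_add_of_disjoint h₁ h₂ hd]
  exact CalderonSplittingLp.divPotential_add (contDiff_drift h₁ ν) (hasCompactSupport_drift h₁c ν)
    (contDiff_drift h₂ ν) (hasCompactSupport_drift h₂c ν)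

/-- **The NS acceleration is additive on disjoint supports.** [cite: MajdaBertozziCUP2002, §1.8 Prop. 1.16] -/
theorem accel_add_of_disjoint (x : EuclideanSpace ℝ (Fin 3)) :
    accel ν (U₁ + U₂) x = accel ν U₁ x + accel ν U₂ x := by
  have hπ₁ : DifferentiableAt ℝ (pot ν U₁) x := ((contDiff_pot h₁ h₁c ν).differentiable (by simp)) x
  have hπ₂ : DifferentiableAt ℝ (pot ν U₂) x := ((contDiff_pot h₂ h₂c ν).differentiable (by simp)) x
  rw [accel_apply, accel_apply, accel_apply, pot_add_of_disjoint h₁ h₁c h₂ h₂c hd,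
    CalderonSplittingLp.gradient_add_apply' hπ₁ hπ₂, drift_add_of_disjoint h₁ h₂ hd]
  simp only
  abel

/-- **Off `tsupport U₂` the far structures contribute a pressure gradient only**:
`V[U₁+U₂](x) = V[U₁](x) − ∇π[U₂](x)`. [folklore] -/
theorem accel_add_of_notMem {x : EuclideanSpace ℝ (Fin 3)} (hx : x ∉ tsupport U₂) :
    accel ν (U₁ + U₂) x = accel ν U₁ x - gradient (pot ν U₂) x := by
  rw [accel_add_of_disjoint h₁ h₁c h₂ h₂c hd x, (accel_eventuallyEq_neg_gradient ν hx).eq_of_nhds]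
  abel

end Disjoint

/-! ## §4 The anchor test of a symmetric composite profile -/

/-- **THE ANCHOR TEST OF A SYMMETRIC COMPOSITE PROFILE IS ONE FAR-FIELD PRESSURE NUMBER.** Let
`U = U₁ + U₂` with `U₁, U₂ ∈ C_c^∞` of DISJOINT supports, `U₁` divergence free and EVEN about `x₀`, and
`x₀ ∉ tsupport U₂`. Then
`⟪U(x₀), V(x₀)⟫ = ν⟪U₁(x₀), ΔU₁(x₀)⟫ − ⟪U₁(x₀), ∇π[U₂](x₀)⟫`, `π[U₂] = Δ⁻¹ div(νΔU₂ − (U₂·∇)U₂)`: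
the strict test at `x₀` holds iff the far structures' pressure gradient pushes along `U₁(x₀)` harder
than viscosity brakes. [cite: MajdaBertozziCUP2002, §1.8 Prop. 1.16] -/
theorem inner_accel_of_even_add_far {ν : ℝ} {U₁ U₂ : EuclideanSpace ℝ (Fin 3) → EuclideanSpace ℝ (Fin 3)}
    {x₀ : EuclideanSpace ℝ (Fin 3)} (h₁ : ContDiff ℝ ∞ U₁) (h₁c : HasCompactSupport U₁)
    (hdiv₁ : VectorCalculus.IsDivFree U₁) (he : IsEvenAbout x₀ U₁)
    (h₂ : ContDiff ℝ ∞ U₂) (h₂c : HasCompactSupport U₂)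
    (hd : Disjoint (tsupport U₁) (tsupport U₂)) (hx₀ : x₀ ∉ tsupport U₂) :
    ⟪(U₁ + U₂) x₀, accel ν (U₁ + U₂) x₀⟫ =
      ν * ⟪U₁ x₀, (Δ U₁) x₀⟫ - ⟪U₁ x₀, gradient (pot ν U₂) x₀⟫ := by
  have hU₂0 : U₂ x₀ = 0 := image_eq_zero_of_notMem_tsupport hx₀
  rw [accel_add_of_notMem h₁ h₁c h₂ h₂c hd hx₀, Pi.add_apply, hU₂0, add_zero, inner_sub_right,
    he.inner_accel_center h₁ h₁c hdiv₁ ν]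

/-- **Corollary (the test as an inequality)**: under the same hypotheses the strict anchor test at `x₀`
holds iff `⟪U₁(x₀), ∇π[U₂](x₀)⟫ < ν⟪U₁(x₀), ΔU₁(x₀)⟫`, i.e. the pressure work `−⟪U₁, ∇π[U₂]⟫(x₀)`
exceeds the viscous braking `−ν⟪U₁, ΔU₁⟫(x₀) ≥ 0`. [folklore] -/
theorem anchor_test_iff_of_even_add_far {ν : ℝ} {U₁ U₂ : EuclideanSpace ℝ (Fin 3) → EuclideanSpace ℝ (Fin 3)}
    {x₀ : EuclideanSpace ℝ (Fin 3)} (h₁ : ContDiff ℝ ∞ U₁) (h₁c : HasCompactSupport U₁)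
    (hdiv₁ : VectorCalculus.IsDivFree U₁) (he : IsEvenAbout x₀ U₁)
    (h₂ : ContDiff ℝ ∞ U₂) (h₂c : HasCompactSupport U₂)
    (hd : Disjoint (tsupport U₁) (tsupport U₂)) (hx₀ : x₀ ∉ tsupport U₂) :
    0 < ⟪(U₁ + U₂) x₀, accel ν (U₁ + U₂) x₀⟫ ↔
      ⟪U₁ x₀, gradient (pot ν U₂) x₀⟫ < ν * ⟪U₁ x₀, (Δ U₁) x₀⟫ := by
  rw [inner_accel_of_even_add_far h₁ h₁c hdiv₁ he h₂ h₂c hd hx₀]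
  constructor <;> intro h <;> linarith

end Summit.NavierStokesRegularity.FluidComputer.PalasekTowerClayBridge.Germ

end
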